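import Mathlib
import Summits.Ventures.HodgeRepro.Tier4.Common.AdelicDefs
import Summits.Ventures.HodgeRepro.Tier4.Common.AdelicRTF
import Summits.Ventures.HodgeRepro.Tier4.Common.MixedPlane
import Summits.Ventures.HodgeRepro.Tier4.Line1.CocompactReduction

/-!
# Tier4/Common/CentralConsistency — N2 (`χ = χ′` on the centre) is FORCED by the mixed-period clause of the L4 wall
(t4-plan-4 S12923 (3), answered S12929 (a): the dictionary point, on the kernel)

Blind re-derivation cell `pub-hodge-repro`, Tier 4 (README §9–§10), seat t4-typer-2 (gen 2).  Target tree path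
`lean/Summits/Ventures/HodgeRepro/Tier4/Common/CentralConsistency.lean`.  Imports `AdelicDefs`, `AdelicRTF`
(`RTFData`, `periodLin`, `periodLin_eq_integral`), `MixedPlane` (`conjChar`, `restrictTo`).

THE COMPUTATION.  Let `v′ : G(𝔸_k) → ℂ` be automorphic (left `G(k)`-invariant) and `χ̄′`-equivariant under `T′`
(`v′(x t′) = χ̄′(t′) v′(x)` — L4-p1's `IsRieszVector`), and `z ∈ centre W ⊆ T ∩ T′`.  The mixed period
`P_χ(v′) = ∫_{D_T} χ(t) v′(t) dμ_T` is unchanged when `D_T` is replaced by its right translate `D_T · z` (a fundamental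
domain of `T(k)` again: `isFundamentalDomain_mul_right`; the integrand is left `T(k)`-invariant), and the change of
variables `t ↦ t z` (right-invariance of `μ_T`) turns that integral into `χ(z) χ̄′(z) · P_χ(v′)`.  Hence
**`periodLin_eq_mul_of_central`**: `P_χ(v′) = χ(z) · χ̄′(z) · P_χ(v′)`, and **`chi_eq_of_periodLin_ne_zero`**: if
`P_χ(v′) ≠ 0` and `|χ′(z)| = 1` then `χ(z) = χ′(z)`.  So the wall's hypothesis `RTFData.chi_centre` (N2) is exactly the
consistency condition of its conclusion (C4) as typed; the conjugation of the dictionary sits in `RTFData.J`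
(S12929 (b)), not in (C4).  Hypotheses displayed: `[R.μT.IsMulRightInvariant]` (true for the commutative torus of a
row plane — the blocks `x + y ω` commute, RowTorus — and for every right-invariant Haar measure), integrability of the
integrand on `D_T` (the regime in which `periodLin` is the integral, `periodLin_eq_integral`).

Nothing here says anything about the status of the Hodge conjecture for CM abelian varieties, which is NOT proved
(HC_CM is NOT proved by anyone in this repository).
-/

set_option autoImplicit false

noncomputable section

namespace Summit.Ventures.HodgeRepro.Tier4.Common

open MeasureTheory

section Translate

variable {k : Type} [Field k] [NumberField k] (W : PlaneData k)

/-- **The right translate of a fundamental domain of `T(k)` in `T(𝔸_k)` by any `z ∈ T(𝔸_k)` is a fundamental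
domain** (for a right-invariant measure): right multiplication commutes with the left action of the rational points. -/
theorem isFundamentalDomain_mul_right [MeasurableSpace (torusT W)] [BorelSpace (torusT W)] (μ : Measure (torusT W))
    [μ.IsMulRightInvariant] (D : Set (torusT W)) (hD : IsFundamentalDomain (rationalOf W (torusT W)) D μ)
    (z : torusT W) : IsFundamentalDomain (rationalOf W (torusT W)) ((· * z) '' D) μ := by
  have hq : Measure.QuasiMeasurePreserving (Equiv.mulRight z).symm μ μ := by
    rw [Equiv.mulRight_symm]
    exact (measurePreserving_mul_right μ z⁻¹).quasiMeasurePreserving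
  have h := hD.image_of_equiv (Equiv.mulRight z) hq (Equiv.refl _) (fun γ x => by
    change (γ : torusT W) * x * z = (γ : torusT W) * (x * z)
    exact mul_assoc _ _ _)
  simpa only [Equiv.coe_mulRight] using h

/-- The integral over a fundamental domain of a left-`T(k)`-invariant function equals the integral over its right
translate, which is the integral of the right-translated function. -/
theorem setIntegral_eq_setIntegral_mul_right [MeasurableSpace (torusT W)] [BorelSpace (torusT W)]
    (μ : Measure (torusT W)) [μ.IsMulLeftInvariant] [μ.IsMulRightInvariant] (D : Set (torusT W))
    (hD : IsFundamentalDomain (rationalOf W (torusT W)) D μ) (F : torusT W → ℂ)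
    (hF : ∀ (γ : rationalOf W (torusT W)) (t : torusT W), F ((γ : torusT W) * t) = F t) (z : torusT W) :
    ∫ t in D, F t ∂μ = ∫ t in D, F (t * z) ∂μ := by
  haveI : SMulInvariantMeasure (rationalOf W (torusT W)) (torusT W) μ :=
    ⟨fun γ s hs => Measure.IsMulLeftInvariant.smulInvariantMeasure.1 (γ : torusT W) hs⟩
  haveI : Countable (rationalOf W (torusT W)) := Line1.rationalOf_countable W (torusT W)
  have h1 : ∫ t in D, F t ∂μ = ∫ t in (· * z) '' D, F t ∂μ :=
    hD.setIntegral_eq (isFundamentalDomain_mul_right W μ D hD z) (fun γ t => hF γ t)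
  rw [h1]
  exact (measurePreserving_mul_right μ z).setIntegral_image_emb (measurableEmbedding_mulRight z) F D

end Translate

section Central

variable {k : Type} [Field k] [NumberField k] (W : PlaneData k)
  [MeasurableSpace (torusT W)] [BorelSpace (torusT W)] [MeasurableSpace (torusT' W)]

/-- **The mixed period of a `χ̄′`-equivariant automorphic vector picks up `χ(z) χ̄′(z)` from a central `z`**:
`P_χ(v′) = χ(z) · χ̄′(z) · P_χ(v′)` for every `z ∈ centre W` (the integrand integrable on `D_T`, `μ_T` right-invariant). -/
theorem periodLin_eq_mul_of_central (R : RTFData W) [R.μT.IsMulLeftInvariant] [R.μT.IsMulRightInvariant]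
    (v' : GA W → ℂ)
    (hv'_aut : ∀ (γ : GA W), γ ∈ rationalPoints W → ∀ x, v' (γ * x) = v' x)
    (hv'_eq : ∀ (x : GA W) (t' : torusT' W), v' (x * t') = conjChar W R.chi' t' * v' x)
    (hint : Integrable (fun t => R.chi t * restrictTo W (torusT W) v' t) (R.μT.restrict R.DT))
    (z : GA W) (hz : z ∈ centre W) :
    periodLin W R.μT R.DT R.chi (restrictTo W (torusT W) v') =
      R.chi ⟨z, centre_le_torusT W hz⟩ * conjChar W R.chi' ⟨z, centre_le_torusT' W hz⟩ *
        periodLin W R.μT R.DT R.chi (restrictTo W (torusT W) v') := by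
  set zT : torusT W := ⟨z, centre_le_torusT W hz⟩ with hzT
  set zT' : torusT' W := ⟨z, centre_le_torusT' W hz⟩ with hzT'
  set F : torusT W → ℂ := fun t => R.chi t * restrictTo W (torusT W) v' t with hF
  -- the integrand is left `T(k)`-invariant
  have hinv : ∀ (γ : rationalOf W (torusT W)) (t : torusT W), F ((γ : torusT W) * t) = F t := by
    intro γ t
    have haut := hv'_aut ((γ : torusT W) : GA W) γ.2 (t : GA W)
    simp only [hF, restrictTo, R.chi_mul, R.chi_rational _ γ.2, one_mul, Subgroup.coe_mul]
    rw [haut]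
  -- the right translate of the integrand by `z`
  have htrans : ∀ t : torusT W, F (t * zT) = R.chi zT * conjChar W R.chi' zT' * F t := by
    intro t
    simp only [hF, restrictTo, R.chi_mul, Subgroup.coe_mul]
    have : ((t : GA W) * (zT : GA W)) = (t : GA W) * (zT' : torusT' W) := rfl
    rw [this, hv'_eq]
    ring
  rw [periodLin_eq_integral W R.μT R.DT R.chi hint]
  calc ∫ t in R.DT, R.chi t * restrictTo W (torusT W) v' t ∂(R.μT)
      = ∫ t in R.DT, F t ∂(R.μT) := rfl
    _ = ∫ t in R.DT, F (t * zT) ∂(R.μT) :=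
        setIntegral_eq_setIntegral_mul_right W R.μT R.DT R.DT_fund F hinv zT
    _ = ∫ t in R.DT, R.chi zT * conjChar W R.chi' zT' * F t ∂(R.μT) := by simp only [htrans]
    _ = R.chi zT * conjChar W R.chi' zT' * ∫ t in R.DT, F t ∂(R.μT) := integral_const_mul _ _

/-- **N2 is forced by (C4)**: if the mixed period of a `χ̄′`-equivariant automorphic vector is non-zero and
`|χ′(z)| = 1`, then `χ(z) = χ′(z)` for every central `z`. -/
theorem chi_eq_of_periodLin_ne_zero (R : RTFData W) [R.μT.IsMulLeftInvariant] [R.μT.IsMulRightInvariant]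
    (v' : GA W → ℂ)
    (hv'_aut : ∀ (γ : GA W), γ ∈ rationalPoints W → ∀ x, v' (γ * x) = v' x)
    (hv'_eq : ∀ (x : GA W) (t' : torusT' W), v' (x * t') = conjChar W R.chi' t' * v' x)
    (hint : Integrable (fun t => R.chi t * restrictTo W (torusT W) v' t) (R.μT.restrict R.DT))
    (hne : periodLin W R.μT R.DT R.chi (restrictTo W (torusT W) v') ≠ 0)
    (z : GA W) (hz : z ∈ centre W) (hunit : ‖R.chi' ⟨z, centre_le_torusT' W hz⟩‖ = 1) :
    R.chi ⟨z, centre_le_torusT W hz⟩ = R.chi' ⟨z, centre_le_torusT' W hz⟩ := by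
  have h := periodLin_eq_mul_of_central W R v' hv'_aut hv'_eq hint z hz
  set P := periodLin W R.μT R.DT R.chi (restrictTo W (torusT W) v') with hP
  set a := R.chi ⟨z, centre_le_torusT W hz⟩ with ha
  set b := R.chi' ⟨z, centre_le_torusT' W hz⟩ with hb
  have h1 : a * starRingEnd ℂ b = 1 := by
    have : (a * starRingEnd ℂ b - 1) * P = 0 := by
      have h' : P = a * starRingEnd ℂ b * P := h
      linear_combination -h'
    rcases mul_eq_zero.1 this with h0 | h0
    · linear_combination h0
    · exact absurd h0 hne
  -- `|b| = 1` gives `b * conj b = 1`, so `a = b`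
  have hbb : b * starRingEnd ℂ b = 1 := by
    rw [Complex.mul_conj, Complex.normSq_eq_norm_sq, hunit]
    norm_num
  have hb0 : starRingEnd ℂ b ≠ 0 := by
    intro h0
    rw [h0, mul_zero] at hbb
    exact zero_ne_one hbb
  exact mul_right_cancel₀ hb0 (h1.trans hbb.symm)

end Central

/-! ## v0.2 (append): the contrapositive under the name t4-plan-4 asked for (S12948) -/

section Contrapositive

variable {k : Type} [Field k] [NumberField k] (W : PlaneData k)
  [MeasurableSpace (torusT W)] [BorelSpace (torusT W)] [MeasurableSpace (torusT' W)]

/-- **The mixed period vanishes when `χ ≠ χ′` at a central `z`** (with `|χ′(z)| = 1`): the contrapositive of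
`chi_eq_of_periodLin_ne_zero` — the kernel statement that the wall's N2 is forced by (C4). -/
theorem mixedPeriod_eq_zero_of_chi_ne (R : RTFData W) [R.μT.IsMulLeftInvariant] [R.μT.IsMulRightInvariant]
    (v' : GA W → ℂ)
    (hv'_aut : ∀ (γ : GA W), γ ∈ rationalPoints W → ∀ x, v' (γ * x) = v' x)
    (hv'_eq : ∀ (x : GA W) (t' : torusT' W), v' (x * t') = conjChar W R.chi' t' * v' x)
    (hint : Integrable (fun t => R.chi t * restrictTo W (torusT W) v' t) (R.μT.restrict R.DT))
    (z : GA W) (hz : z ∈ centre W) (hunit : ‖R.chi' ⟨z, centre_le_torusT' W hz⟩‖ = 1)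
    (hne : R.chi ⟨z, centre_le_torusT W hz⟩ ≠ R.chi' ⟨z, centre_le_torusT' W hz⟩) :
    periodLin W R.μT R.DT R.chi (restrictTo W (torusT W) v') = 0 := by
  by_contra h
  exact hne (chi_eq_of_periodLin_ne_zero W R v' hv'_aut hv'_eq hint h z hz hunit)

end Contrapositive

end Summit.Ventures.HodgeRepro.Tier4.Common

end
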